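import Mathlib
import Summits.Ventures.PercRepro2.V2SP
import Summits.Ventures.PercRepro2.HallOffFrame
import Summits.Ventures.PercRepro2.HallOffAxis
import Summits.Ventures.PercRepro2.Tail2DOffAxis31
import Summits.Ventures.PercRepro2.Tail2DStepRowZero
import Summits.Ventures.PercRepro2.Tail2DStepCert
import Summits.Ventures.PercRepro2.Tail2DUnitStep
import Summits.Ventures.PercRepro2.Tail2DUnitStepRowZero
import Summits.Ventures.PercRepro2.Tail2DQStepCert
import Summits.Ventures.PercRepro2.Tail2DQStepCert13

/-!
# QSTEP(1,3) on every series–parallel network: `3·#{r = 1 ∧ b ≥ 3} ≤ 2·#{r = 2 ∧ b ≥ 2}`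
(seat mine-b, cell pub-perc-repro2; MINE-B.md §39.17)

The first off-row member of the binomial-ratio form of STEP (§10.3c), tight on the bundle of four edges
(`3·4 = 2·6`): a configuration with one red path and three disjoint blue paths is, with weight 3, rarer than a
configuration with two disjoint red paths and two disjoint blue paths with weight 2.  Induction over the grammar:
the atoms have flows `≤ 1`; the series step is `qstep_ser` with the anti-diagonal comparisons `T(1,3) ≤ T(2,2)`
(`t31_le_t22` after the colour swap) and `T(2,3) = T(3,2)`; the parallel step is the kernel-decided certificate
`qstep13_par` of `Tail2DQStepCert13.lean`, whose hypotheses on the factors are the row `i = 0` of QSTEP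
(`qstep_row_zero`), the axis members, the STEP members `psi 0 3`, `psi 1 2`, and QSTEP(1,3) itself.
-/

namespace Summit.Ventures.PercRepro2.Tail2D

open V2Closure

/-- the count of `psi 1 2` (the offset-one member, equal to the count of `psi 1 3` = STEP(1,3) = `t31_le_t22`) -/
lemma sum_psi_one_two_nonneg (s : V2Closure.SP) : 0 ≤ ∑ x, psi 1 2 (s.rLab x) (s.bLab x) := by
  rw [sum_psi_offset_one s 1]
  refine (step_iff' s 1 3).1 ?_
  have h := (step_diag_iff s 1).2 (t31_le_t22 s)
  exact h

/-- the count of `qpsi 0 j` (the row `i = 0`, `qstep_row_zero`) -/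
lemma sum_qpsi_zero_nonneg (s : V2Closure.SP) (j : ℕ) : 0 ≤ ∑ x, qpsi 0 j (s.rLab x) (s.bLab x) := by
  refine (qstep_iff' s 0 j).1 ?_
  have h := qstep_row_zero s j
  simpa using h

/-- **QSTEP(1,3) on every pattern of the grammar** -/
theorem qstep13 : ∀ s : V2Closure.SP,
    3 * (Finset.univ.filter (fun y : s.Conf => s.rLab y = 1 ∧ 3 ≤ s.bLab y)).card
      ≤ (1 + 1) * (Finset.univ.filter (fun y : s.Conf => s.rLab y = 1 + 1 ∧ 3 - 1 ≤ s.bLab y)).card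
  | .free => by
    rw [Finset.card_eq_zero.2 (Finset.filter_eq_empty_iff.2 (fun y _ => by
      have := atom_bLab_le_one .free (Or.inl rfl) y; omega))]
    exact Nat.zero_le _
  | .pin => by
    rw [Finset.card_eq_zero.2 (Finset.filter_eq_empty_iff.2 (fun y _ => by
      have := atom_bLab_le_one .pin (Or.inr (Or.inl rfl)) y; omega))]
    exact Nat.zero_le _
  | .absent => by
    rw [Finset.card_eq_zero.2 (Finset.filter_eq_empty_iff.2 (fun y _ => by
      have := atom_bLab_le_one .absent (Or.inr (Or.inr rfl)) y; omega))]
    exact Nat.zero_le _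
  | .ser s t => by
    refine qstep_ser s t 1 3 (qstep13 s) (qstep13 t) ?_ ?_
    · -- `T(1,3) ≤ T(2,2)`: `t31_le_t22` after the colour swap
      rw [tail_symm t 1 3]
      exact t31_le_t22 t
    · -- `T(2,3) = T(3,2)`
      exact le_of_eq (tail_symm s (1 + 1) 3)
  | .par s t => by
    refine (qstep_iff' (.par s t) 1 3).2 (qstep13_par s t ?_ ?_ ?_ ?_ ?_ ?_ ?_ ?_ ?_ ?_ ?_ ?_ ?_ ?_ ?_)
    · exact SP.hallFn_phi_axis_count s 1 (by norm_num)
    · exact SP.hallFn_phi_axis_count s 2 (by norm_num)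
    · exact SP.hallFn_phi_axis_count s 3 (by norm_num)
    · exact SP.sum_psi_zero_nonneg s 3 (by norm_num)
    · exact sum_psi_one_two_nonneg s
    · exact sum_qpsi_zero_nonneg s 2
    · exact sum_qpsi_zero_nonneg s 3
    · exact (qstep_iff' s 1 3).1 (qstep13 s)
    · exact SP.hallFn_phi_axis_count t 2 (by norm_num)
    · exact SP.hallFn_phi_axis_count t 3 (by norm_num)
    · exact SP.sum_psi_zero_nonneg t 3 (by norm_num)
    · exact sum_psi_one_two_nonneg t
    · exact sum_qpsi_zero_nonneg t 2
    · exact sum_qpsi_zero_nonneg t 3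
    · exact (qstep_iff' t 1 3).1 (qstep13 t)

/-- the same with the numerals evaluated: `3·#{r = 1 ∧ b ≥ 3} ≤ 2·#{r = 2 ∧ b ≥ 2}` -/
theorem qstep13' (s : V2Closure.SP) :
    3 * (Finset.univ.filter (fun y : s.Conf => s.rLab y = 1 ∧ 3 ≤ s.bLab y)).card
      ≤ 2 * (Finset.univ.filter (fun y : s.Conf => s.rLab y = 2 ∧ 2 ≤ s.bLab y)).card :=
  qstep13 s

end Summit.Ventures.PercRepro2.Tail2D
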